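import Literature.NumberTheory.DiophantineGeometry.AbcWave0GranvilleStarkHeightProofs
import HarnessLib

/-!
# Granville–Stark, Theorem 1 with `∑ 1/a`, for an ARBITRARY discriminant constant

Topic `Literature/NumberTheory/DiophantineGeometry`; a proofs-only companion (theorems only, no
definitions, no named facts) of `AbcWave0GranvilleStarkHeightProofs.lean`.

`pi_mul_sqrt_mul_sum_inv_le_of_uniformABC_of_sq` — the `∑ 1/a` form of Granville–Stark's Theorem 1
(`π√|D| ∑_{Q reduced} 1/a_Q ≤ h(D)((3(1+ε)/(1−5ε)) log|D| + C₀)`) from uniform `abc` and CM data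
`g₂³ = j(τ_D) = g₃² + 1728` in a number field `K` with `|D_K| ≤ (B²|D|)^{[K:ℚ]/2}`, i.e.
`Δ_K ≤ B√|D|`, for ANY `B ≥ 1` (the constant `C₀` depends on `B, ε`).  This is
`pi_mul_sqrt_mul_sum_inv_le_of_uniformABC` with Granville–Stark's `36 = 6²` replaced by `B²`; the
proof is the same — `B` only enters `log|D_K| ≤ (n/2)(log B² + log|D|)` and the constant `A` of the
bookkeeping lemma `theorem1_arith` (which was already stated with a free parameter `L36`).  Used by
`AbcWave0GranvilleStarkTheorem2AnyConstantProofs.lean` to deduce Theorem 2 (abc.S22) from Lemma 1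
with an arbitrary constant (Granville–Stark, remark after Lemma 1: "A more careful analysis would
allow us to reduce the factor of 6").

## References

* A. Granville, H. M. Stark, Invent. Math. 139 (2000) 509–523, Theorem 1, §2 (Lemma 1 and the
  remark after it, (5)–(7)). [GranvilleStark2000]
-/

noncomputable section

open scoped NumberField

namespace Literature.NumberTheory.DiophantineGeometry

open _root_.Literature.NumberTheory.EllipticCurves
open _root_.Literature.NumberTheory.QuadraticFields.BinaryQuadraticForm

/-! ### Theorem 1 with `∑ 1/a` for an arbitrary discriminant constant -/

section HeightArgument

open scoped IntermediateField
open Polynomial NumberField IsDedekindDomain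

-- the proof of `pi_mul_sqrt_mul_sum_inv_le_of_uniformABC` is already close to the default heartbeat
-- limit; with a symbolic constant `B` in place of `36` a few `positivity`/`norm_num` calls cost more
set_option maxHeartbeats 800000 in
/-- **Granville–Stark, Theorem 1 with `∑ 1/a`, from uniform `abc` and CM data with an arbitrary
constant.**  As `pi_mul_sqrt_mul_sum_inv_le_of_uniformABC`, but with the discriminant hypothesis
`|D_K| ≤ (B²|D|)^{[K:ℚ]/2}` (`Δ_K ≤ B√|D|`) for any `B ≥ 1` in place of Granville–Stark's `B = 6`:
for `0 < ε < 1/5` there is `C₀ = C₀(ε, B)` with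
`π√|D| ∑_{Q reduced} 1/a_Q ≤ h(D)((3(1+ε)/(1−5ε)) log|D| + C₀)` for all such data.
[cite: GranvilleStark2000, Theorem 1 (proof, §2) and the remark after Lemma 1] -/
theorem pi_mul_sqrt_mul_sum_inv_le_of_uniformABC_of_sq (habc : UniformABCConjecture)
    {ε : ℝ} (hε : 0 < ε) (hε5 : ε < 1 / 5) {B : ℝ} (hB : 1 ≤ B) :
    ∃ C₀ : ℝ, ∀ (D : ℤ), D < 0 → (D % 4 = 0 ∨ D % 4 = 1) →
      ∀ (K : Type) [Field K] [NumberField K] (ι : K →+* ℂ) (g₂ g₃ : 𝓞 K),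
        ι (g₂ : K) ^ 3 = formJ (principalForm D) →
        ι (g₃ : K) ^ 2 = formJ (principalForm D) - 1728 →
        |(NumberField.discr K : ℝ)| ≤ (B ^ (2 : ℕ) * |(D : ℝ)|) ^ ((Module.finrank ℚ K : ℝ) / 2) →
        Real.pi * √(-(D : ℝ)) * ∑ Q ∈ reducedForms D, (1 : ℝ) / Q.1 ≤
          classNumber D * (3 * (1 + ε) / (1 - 5 * ε) * Real.log (-(D : ℝ)) + C₀) := by
  classical
  obtain ⟨C, hC⟩ := habc ε hε
  -- constants
  set C' : ℝ := max |C| 1 with hC'def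
  have hC'1 : 1 ≤ C' := le_max_right _ _
  have hC'0 : 0 < C' := one_pos.trans_le hC'1
  have hκ : 0 < 1 - 5 * ε := by linarith
  set A : ℝ := Real.log C' + Real.log 1728 +
    (1 + ε) * (Real.log (B ^ (2 : ℕ)) / 2 + Real.log 6 + Real.log 1729 / 2) with hAdef
  have hA0 : 0 ≤ A := by
    have h1 : 0 ≤ Real.log C' := Real.log_nonneg hC'1
    have h2 : 0 ≤ Real.log 1728 := Real.log_nonneg (by norm_num)
    have h3 : 0 ≤ Real.log (B ^ (2 : ℕ)) := Real.log_nonneg (one_le_pow₀ hB)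
    have h4 : 0 ≤ Real.log 6 := Real.log_nonneg (by norm_num)
    have h5 : 0 ≤ Real.log 1729 := Real.log_nonneg (by norm_num)
    have h6 : 0 ≤ 1 + ε := by linarith
    rw [hAdef]
    exact add_nonneg (add_nonneg h1 h2) (mul_nonneg h6 (by linarith))
  refine ⟨6 * A / (1 - 5 * ε) + 28, ?_⟩
  intro D hD h4 K _ _ ι g₂ g₃ hg₂ hg₃ hdisc
  -- notation and basic facts
  have hD3 : D ≤ -3 := by omega
  set d : ℝ := -(D : ℝ) with hddef
  have hd3 : (3 : ℝ) ≤ d := by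
    have : ((D : ℤ) : ℝ) ≤ -3 := by exact_mod_cast hD3
    rw [hddef]; linarith
  have hd0 : 0 < d := by linarith
  have habsD : |(D : ℝ)| = d := by
    rw [hddef, abs_of_neg (by exact_mod_cast hD)]
  set n : ℕ := Module.finrank ℚ K with hndef
  have hn : 0 < n := Module.finrank_pos
  have hn' : (0 : ℝ) < n := by exact_mod_cast hn
  set h : ℕ := classNumber D with hhdef
  have hh : 0 < h := classNumber_pos hD h4
  have hh' : (0 : ℝ) < h := by exact_mod_cast hh
  have hP : principalForm D ∈ reducedForms D := principalForm_mem_reducedForms hD h4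
  have hlogd : 0 ≤ Real.log d := Real.log_nonneg (by linarith)
  have hcoef : 0 ≤ 3 * (1 + ε) / (1 - 5 * ε) := by positivity
  -- every reduced form has `a ≥ 1` and discriminant `D`
  have hQ : ∀ Q ∈ reducedForms D, discr Q = D ∧ 0 < Q.1 := fun Q hQ =>
    let h := (mem_reducedForms_iff hD).1 hQ
    ⟨h.1, h.2.1⟩
  have hsum_le : ∑ Q ∈ reducedForms D, (1 : ℝ) / Q.1 ≤ h := by
    calc ∑ Q ∈ reducedForms D, (1 : ℝ) / Q.1 ≤ ∑ Q ∈ reducedForms D, (1 : ℝ) := by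
          refine Finset.sum_le_sum fun Q hQ' => ?_
          have h1 : (1 : ℝ) ≤ Q.1 := by exact_mod_cast (hQ Q hQ').2
          rw [div_le_one (by linarith)]
          exact h1
      _ = h := by
          rw [Finset.sum_const, nsmul_eq_mul, mul_one, hhdef]
          rfl
  have hsum0 : 0 ≤ ∑ Q ∈ reducedForms D, (1 : ℝ) / Q.1 :=
    Finset.sum_nonneg fun Q hQ' => by
      have h1 : (0 : ℝ) < Q.1 := by exact_mod_cast (hQ Q hQ').2
      positivity
  -- the right-hand side is at least `28 h`
  have hRHS : (h : ℝ) * 28 ≤ h * (3 * (1 + ε) / (1 - 5 * ε) * Real.log d + (6 * A / (1 - 5 * ε) + 28)) := by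
    refine mul_le_mul_of_nonneg_left ?_ hh'.le
    have : 0 ≤ 6 * A / (1 - 5 * ε) := by positivity
    nlinarith
  by_cases hsmall : d ≤ 32
  · -- small discriminants: the bound is trivial
    have hsqrt : √d ≤ 6 := by
      rw [Real.sqrt_le_left (by norm_num)]
      linarith
    have hpi : Real.pi ≤ 4 := Real.pi_le_four
    calc Real.pi * √d * ∑ Q ∈ reducedForms D, (1 : ℝ) / Q.1 ≤ 4 * 6 * h := by
          have := Real.sqrt_nonneg d
          have := Real.pi_pos.le
          gcongr
      _ ≤ h * 28 := by linarith
      _ ≤ _ := hRHS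
  -- large discriminants
  push Not at hsmall
  set jP : ℂ := formJ (principalForm D) with hjPdef
  -- `j(τ_P)` is large, in particular `≠ 0, 1728`
  have hjP : Real.pi * √d - 10 ≤ Real.log (max 1 ‖jP‖) := by
    have := pi_mul_sqrt_div_sub_le_log_norm_formJ (hQ _ hP).2 (by rw [(hQ _ hP).1]; exact hD)
    rw [(hQ _ hP).1, principalForm_fst, Int.cast_one, div_one] at this
    simpa [hddef] using this
  have hsqrt32 : (5.6 : ℝ) < √d := by
    rw [show (5.6 : ℝ) = √(5.6 ^ 2) by rw [Real.sqrt_sq (by norm_num)]]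
    exact Real.sqrt_lt_sqrt (by norm_num) (by nlinarith)
  have hjP' : (1728 : ℝ) < ‖jP‖ := by
    have hpi3 : (3.14 : ℝ) < Real.pi := Real.pi_gt_d2
    have h1 : (7.5 : ℝ) < Real.log (max 1 ‖jP‖) := by
      have hsq0 : 0 ≤ √d - 5.6 := by linarith
      have hpi0 : 0 ≤ Real.pi - 3.14 := by linarith
      nlinarith [mul_nonneg hpi0 hsq0]
    have h2 : Real.log 1728 < 7.5 := by
      have h15 : Real.log ((1728 : ℝ) ^ 2) < 15 := by
        rw [Real.log_lt_iff_lt_exp (by norm_num)]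
        have := Real.exp_one_gt_d9
        have h8 : Real.exp 15 = Real.exp 1 ^ 15 := by rw [← Real.exp_nat_mul]; norm_num
        rw [h8]
        have : (1728 : ℝ) ^ 2 < (2.7182818283 : ℝ) ^ 15 := by norm_num
        have h27 : (2.7182818283 : ℝ) ^ 15 ≤ Real.exp 1 ^ 15 := by gcongr
        linarith
      rw [Real.log_pow] at h15
      push_cast at h15
      linarith
    have h3 : Real.log 1728 < Real.log (max 1 ‖jP‖) := by linarith
    have h4 : (1728 : ℝ) < max 1 ‖jP‖ := by
      rwa [Real.log_lt_log_iff (by norm_num) (lt_of_lt_of_le one_pos (le_max_left _ _))] at h3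
    rcases le_total 1 ‖jP‖ with hle | hle
    · rwa [max_eq_right hle] at h4
    · rw [max_eq_left hle] at h4; linarith
  have hjP0 : jP ≠ 0 := by
    intro h0; rw [h0, norm_zero] at hjP'; linarith
  have hjP1728 : jP - 1728 ≠ 0 := by
    intro h0
    have : jP = 1728 := sub_eq_zero.1 h0
    rw [this] at hjP'
    norm_num at hjP'
  -- the algebraic data in `K`
  set j : K := (g₂ : K) ^ 3 with hjdef
  have hιj : ι j = jP := by rw [hjdef, map_pow, hg₂]
  have hg₃' : ((g₃ : K)) ^ 2 = j - 1728 := by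
    apply ι.injective
    rw [map_pow, hg₃, map_sub, hιj, map_ofNat]
  have hj0 : j ≠ 0 := by
    intro h0; apply hjP0; rw [← hιj, h0, map_zero]
  have hg₂K : (g₂ : K) ≠ 0 := fun h0 => hj0 (by rw [hjdef, h0]; ring)
  have hg₃K : (g₃ : K) ≠ 0 := by
    intro h0
    apply hjP1728
    rw [← hιj, ← map_ofNat ι 1728, ← map_sub, ← hg₃', h0]
    simp
  have hg₂0 : g₂ ≠ 0 := fun h0 => hg₂K (by rw [h0]; rfl)
  have hg₃0 : g₃ ≠ 0 := fun h0 => hg₃K (by rw [h0]; rfl)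
  have hsumK : (1728 : K) + (g₃ : K) ^ 2 = (g₂ : K) ^ 3 := by
    rw [hg₃', ← hjdef]; ring
  -- uniform abc
  have key := hC K (1728 : K) ((g₃ : K) ^ 2) ((g₂ : K) ^ 3) (by norm_num) (pow_ne_zero _ hg₃K)
    (pow_ne_zero _ hg₂K) hsumK
  have hvec : (![(1728 : K), (g₃ : K) ^ 2, (g₂ : K) ^ 3] : Fin 3 → K) = ![(1728 : K), j - 1728, j] := by
    rw [hg₃']
  rw [hvec] at key
  -- the quantities `M`, `N`, `N₂`, `N₃`, `dK`
  set M : ℝ := ∏ w : InfinitePlace K, max 1 (w j) ^ w.mult with hMdef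
  set N : ℝ := (radicalNorm (1728 : K) ((g₃ : K) ^ 2) ((g₂ : K) ^ 3) : ℝ) with hNdef
  set N₂ : ℝ := ((Algebra.norm ℤ g₂).natAbs : ℝ) with hN₂def
  set N₃ : ℝ := ((Algebra.norm ℤ g₃).natAbs : ℝ) with hN₃def
  set dK : ℝ := |(NumberField.discr K : ℝ)| with hdKdef
  have hM1 : 1 ≤ M := by
    rw [hMdef]
    exact Finset.prod_induction _ (fun x : ℝ => 1 ≤ x)
      (fun a b ha hb => one_le_mul_of_one_le_of_one_le ha hb) le_rfl
      fun w _ => one_le_pow₀ (le_max_left _ _)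
  have hM0 : 0 < M := one_pos.trans_le hM1
  have hN1 : 1 ≤ N := by rw [hNdef]; exact_mod_cast one_le_radicalNorm _ _ _
  have hN0 : 0 < N := one_pos.trans_le hN1
  have hN₂1 : 1 ≤ N₂ := by
    rw [hN₂def, Nat.one_le_cast, Nat.one_le_iff_ne_zero, Ne, Int.natAbs_eq_zero,
      Algebra.norm_eq_zero_iff]
    exact hg₂0
  have hN₃1 : 1 ≤ N₃ := by
    rw [hN₃def, Nat.one_le_cast, Nat.one_le_iff_ne_zero, Ne, Int.natAbs_eq_zero,
      Algebra.norm_eq_zero_iff]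
    exact hg₃0
  have hN₂0 : 0 < N₂ := one_pos.trans_le hN₂1
  have hN₃0 : 0 < N₃ := one_pos.trans_le hN₃1
  have hdK1 : 1 ≤ dK := by
    rw [hdKdef, ← Int.cast_abs, ← Int.cast_one, Int.cast_le]
    exact Int.one_le_abs (NumberField.discr_ne_zero K)
  have hdK0 : 0 < dK := one_pos.trans_le hdK1
  -- the four inequalities
  have hMH : M ≤ (1728 : ℝ) ^ n * Height.mulHeight ![(1728 : K), j - 1728, j] :=
    prod_max_pow_le_mulHeight j
  have hNle : N ≤ (6 : ℝ) ^ n * N₂ * N₃ := by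
    rw [hNdef, hN₂def, hN₃def]
    exact_mod_cast radicalNorm_le_of_sq_of_cube hg₂0 hg₃0
  have hN₂le : N₂ ^ 3 ≤ M := natAbs_norm_pow_three_le g₂
  have hN₃le : N₃ ^ 2 ≤ (1729 : ℝ) ^ n * M := natAbs_norm_sq_le g₃ hg₃'
  -- abc in multiplicative form: `M ≤ 1728ⁿ C'ⁿ (dK N)^{1+ε}`
  have hCn : C ^ n ≤ C' ^ n := by
    calc C ^ n ≤ |C ^ n| := le_abs_self _
      _ = |C| ^ n := abs_pow C n
      _ ≤ C' ^ n := pow_le_pow_left₀ (abs_nonneg C) (le_max_left _ _) n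
  have habc' : M ≤ (1728 : ℝ) ^ n * (C' ^ n * (dK * N) ^ (1 + ε)) := by
    have h1 : Height.mulHeight ![(1728 : K), j - 1728, j] ≤ C' ^ n * (dK * N) ^ (1 + ε) := by
      refine key.le.trans ?_
      have : 0 ≤ (dK * N) ^ (1 + ε) := Real.rpow_nonneg (by positivity) _
      exact mul_le_mul_of_nonneg_right hCn this
    calc M ≤ (1728 : ℝ) ^ n * Height.mulHeight ![(1728 : K), j - 1728, j] := hMH
      _ ≤ _ := mul_le_mul_of_nonneg_left h1 (by positivity)
  -- take logarithms: first the two facts using `hdisc` and `habc'`, which are then cleared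
  -- (their real powers make `linarith`'s atom comparison expensive)
  have hB0 : (0 : ℝ) < B ^ (2 : ℕ) := pow_pos (lt_of_lt_of_le one_pos hB) 2
  have h36d : (0 : ℝ) < B ^ (2 : ℕ) * d := mul_pos hB0 hd0
  have hlogdK : Real.log dK ≤ n / 2 * (Real.log (B ^ (2 : ℕ)) + Real.log d) := by
    have h1 := Real.log_le_log hdK0 hdisc
    rw [habsD, Real.log_rpow h36d, Real.log_mul hB0.ne' hd0.ne'] at h1
    linarith only [h1]
  have h1728n : (0 : ℝ) < 1728 ^ n := pow_pos (by norm_num) n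
  have hC'n : (0 : ℝ) < C' ^ n := pow_pos hC'0 n
  have hdKN : (0 : ℝ) < dK * N := mul_pos hdK0 hN0
  have hrpow : (0 : ℝ) < (dK * N) ^ (1 + ε) := Real.rpow_pos_of_pos hdKN _
  have hlogabc : Real.log M ≤ n * Real.log 1728 + n * Real.log C' +
      (1 + ε) * (Real.log dK + Real.log N) := by
    have h1 := Real.log_le_log hM0 habc'
    rw [Real.log_mul h1728n.ne' (mul_pos hC'n hrpow).ne', Real.log_pow,
      Real.log_mul hC'n.ne' hrpow.ne', Real.log_pow,
      Real.log_rpow hdKN, Real.log_mul hdK0.ne' hN0.ne'] at h1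
    linarith only [h1]
  clear key habc' hMH hdisc hrpow
  have hlogM0 : 0 ≤ Real.log M := Real.log_nonneg hM1
  have hlogN₂ : Real.log N₂ ≤ Real.log M / 3 := by
    have h1 : Real.log (N₂ ^ 3) ≤ Real.log M := Real.log_le_log (pow_pos hN₂0 3) hN₂le
    rw [Real.log_pow] at h1
    push_cast at h1
    linarith only [h1]
  have h1729n : (0 : ℝ) < 1729 ^ n := pow_pos (by norm_num) n
  have hlogN₃ : Real.log N₃ ≤ (n * Real.log 1729 + Real.log M) / 2 := by
    have h1 : Real.log (N₃ ^ 2) ≤ Real.log ((1729 : ℝ) ^ n * M) :=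
      Real.log_le_log (pow_pos hN₃0 2) hN₃le
    rw [Real.log_pow, Real.log_mul h1729n.ne' hM0.ne', Real.log_pow] at h1
    push_cast at h1
    linarith only [h1]
  have h6n : (0 : ℝ) < 6 ^ n := pow_pos (by norm_num) n
  have hlogN : Real.log N ≤ n * Real.log 6 + Real.log N₂ + Real.log N₃ := by
    have h1 : Real.log N ≤ Real.log ((6 : ℝ) ^ n * N₂ * N₃) := Real.log_le_log hN0 hNle
    rw [Real.log_mul (mul_pos h6n hN₂0).ne' hN₃0.ne', Real.log_mul h6n.ne' hN₂0.ne',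
      Real.log_pow] at h1
    linarith only [h1]
  -- conjugates: `h · log M = n · ∑_Q log max(1, |j(τ_Q)|)`
  have hlogMsum : Real.log M = ∑ φ : K →+* ℂ, Real.log (max 1 ‖φ j‖) := by
    rw [hMdef, prod_infinitePlace_pow_mult_eq_prod_embeddings (fun t => max 1 t) j,
      Real.log_prod]
    intro φ _
    exact (one_pos.trans_le (le_max_left _ _)).ne'
  have hconj := classNumber_mul_sum_embeddings_eq ι hD h4 hιj (fun z => Real.log (max 1 ‖z‖))
  rw [← hlogMsum] at hconj
  -- the lower bound for the singular moduli
  have hlow : ∑ Q ∈ reducedForms D, (Real.pi * √d / Q.1 - 10) ≤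
      ∑ Q ∈ reducedForms D, Real.log (max 1 ‖formJ Q‖) := by
    refine Finset.sum_le_sum fun Q hQ' => ?_
    have h1 := pi_mul_sqrt_div_sub_le_log_norm_formJ (hQ Q hQ').2
      (by rw [(hQ Q hQ').1]; exact hD)
    rw [(hQ Q hQ').1] at h1
    simpa [hddef] using h1
  have hlow' : ∑ Q ∈ reducedForms D, (Real.pi * √d / Q.1 - 10) =
      Real.pi * √d * ∑ Q ∈ reducedForms D, (1 : ℝ) / Q.1 - 10 * h := by
    rw [Finset.sum_sub_distrib, Finset.mul_sum, Finset.sum_const, nsmul_eq_mul, hhdef]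
    have hcard : ((reducedForms D).card : ℝ) =
        (QuadraticFields.BinaryQuadraticForm.classNumber D : ℝ) := rfl
    rw [hcard, mul_comm _ (10 : ℝ)]
    simp only [mul_one_div]
  -- final assembly
  have hfin : (n : ℝ) * (Real.pi * √d * ∑ Q ∈ reducedForms D, (1 : ℝ) / Q.1 - 10 * h) ≤
      h * Real.log M := by
    calc (n : ℝ) * (Real.pi * √d * ∑ Q ∈ reducedForms D, (1 : ℝ) / Q.1 - 10 * h)
        = n * ∑ Q ∈ reducedForms D, (Real.pi * √d / Q.1 - 10) := by rw [hlow']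
      _ ≤ n * ∑ Q ∈ reducedForms D, Real.log (max 1 ‖formJ Q‖) :=
          mul_le_mul_of_nonneg_left hlow hn'.le
      _ = h * Real.log M := hconj.symm
  exact theorem1_arith hε hε5 hn' hh'.le hA0 hAdef hlogabc hlogdK hlogN hlogN₂ hlogN₃ hfin


end HeightArgument


end Literature.NumberTheory.DiophantineGeometry

end
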